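import Summits.ABC.IUTFork.Cor312StatementStability
import Summits.ABC.IUTFork.ForkLocalGlobal
import HarnessLib

/-!
# [IUTchIII] Cor. 3.12 — the Θ-side local volume bounded by any enclosing scaled stable set, and the
# one-packet deep-place fork modulo container numerics

Record-only file (D-0012) of the abc-iut cell (Cor. 3.12 cone, D-0067; TEAM A seat abc-iut-c312-10; the
`hUB` half of skel FORK-LOCAL-GLOBAL §6 `not_pointwise_real`, design C312-TEAMS §A ~02:1xZ); TAKES NO
SIDE; theorems only, no new `Prop` fact, no instance asserted.

skel §3/§6: the per-packet readings (R0, and through it R2/R3/R4/`VolumeTransport`) assert, at each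
packet, `qLocal ≤ thetaLocal` — which combined with a Step (v)-shape upper bound on the Θ-side
(`thetaLocal ≤ w·qLocal + κ`, [IUTchIV] Thm. 1.10 Step (v), p. 28–29) bounds the local height and FAILS
at a deep bad place. The landed kernel pieces are `Cor312Vol.perPlace_bound_of_pointwise` (XXIV, the
one-packet algebra) and `LocalGlobalNumbers.localGlobal_numbers` (XXIVc, the printed-coefficient shadow).
THIS FILE supplies the missing abstract half AT THE FROZEN SETTING — the Θ-side upper bound from lattice
stability — and assembles the fork, leaving exactly the container numerics open:

* `Cor312Vol.thetaLocal_untopD_le_logvol_of_stable_smul` — under the bridge hypotheses, if every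
  (Ind1)/(Ind2)-family maps `W` onto itself and the (Ind3)-enlarged Θ-region lies in the rational
  multiple `c • W`, itself a hull-set of the frame (the shape `λ·𝒪 ⊇ q^{w}·(lattice)` of Dupuy–Hilado
  (4.10)), then the local Θ-volume at that packet is at most `logvol (c • W)`: the packet hull lies
  inside `c • W` (landed `sUnion_possibleImages_subset_smul`, c312-7) and the log-volume is monotone on
  admissible regions (`BridgeHyps.mono`). This is the Step (v)-SHAPE bound at the frozen setting MODULO
  evaluating `logvol (c • W)` — the container seam (c312-5's lattice files; at the assembled real
  settings `logvol (e⁻¹(q^w·Λ))` has a closed form there).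
* `Cor312Vol.not_pointwise_of_deep_packet` — the ONE-PACKET DEEP-PLACE FORK: if moreover
  `logvol (c • W) ≤ w·qLocal + κ` (the container numerics, NAMED) and the packet is DEEP
  (`κ < (w − 1)·(−qLocal)`, i.e. `ord(q)` beyond the threshold of XXIVc), then the per-packet reading
  `∀ i v_ℚ, qLocal ≤ thetaLocal` is FALSE — kernel form of skel §3 at any frozen setting whose packet
  carries the stability and numerics data. With c312-5's lattice instantiation this yields
  `not_pointwise_real` (§6) at the assembled real settings by pure instantiation.

HONEST SCOPE: the numerics hypothesis `hnum` and the depth hypothesis `hdeep` are NAMED, discharged for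
no instance here; nothing asserts that the intended setting satisfies or violates any reading; the
per-packet readings are the STRONGER-THAN-PRINT sufficient family (ADJUDICATION-SPEC §2 (G1′)), and
their failure at deep places says nothing about the GLOBAL printed inequality (XXIVc
`global_of_compensation`). [claim: Mochizuki2012, status: disputed]
[cite: DupuyHilado2025, §4.10, §4.12] [cite: ScholzeStix2018, §2.2 pp. 9–10]
-/

noncomputable section

namespace Summit.ABC

namespace IUTFork

namespace Cor312Vol

open Thm311 Cor312 Cor312.Setting Literature.IUT.LogThetaLattice

variable {T : ThetaIndex} {S : Situation T} {P : Cor312.Setting S}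

open scoped Pointwise in
/-- **The Θ-side local volume is bounded by any enclosing scaled stable hull-set**: under the bridge
hypotheses, if every (Ind1)/(Ind2)-family maps `W` onto itself, the (Ind3)-enlarged Θ-region lies in
`c • W` (`c : ℚ`; Dupuy–Hilado (4.10): the region sits in a lattice multiple), and `c • W` is a hull-set
of the frame, then `thetaLocal ≤ logvol (c • W)` at that packet: the union of ALL possible images lies in
`c • W` (landed `sUnion_possibleImages_subset_smul`), hence so does its hull ("smallest"), and the
log-volume is monotone on admissible regions. The Step (v)-shape upper bound at the frozen setting,
modulo the container value of `logvol (c • W)`. [claim: Mochizuki2012, status: disputed] -/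
theorem thetaLocal_untopD_le_logvol_of_stable_smul (H : BridgeHyps P) (i : Fin T.lstar) (vQ : T.VQ)
    {W : Set (S.L.Packet (Setting.labelSucc i) vQ)}
    (hW : ∀ Φ ∈ S.L.Ind1Family ∪ S.L.Ind2Family, Φ (Setting.labelSucc i) vQ '' W = W) (c : ℚ)
    (h3 : P.thetaRegion3 (Setting.labelSucc i) vQ ⊆ c • W)
    (hHul : c • W ∈ (P.frame (Setting.labelSucc i) vQ).Hul) :
    (P.thetaLocal (Setting.labelSucc i) vQ).untopD 0 ≤
      (S.D P.n).logvol (Setting.labelSucc i) vQ (c • W) := by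
  rw [thetaLocal_untopD H i vQ]
  have hsub : P.thetaHull (Setting.labelSucc i) vQ ⊆ c • W :=
    (P.frame (Setting.labelSucc i) vQ).hull_subset_of_mem hHul
      (P.sUnion_possibleImages_subset_smul hW c h3)
  exact H.mono i vQ (P.thetaHull_adm (hullDefined_of_finite H i vQ))
    (P.hul_adm _ vQ _ hHul) hsub

open scoped Pointwise in
/-- **The one-packet deep-place fork, modulo container numerics**: under the bridge hypotheses, at a
packet carrying an (Ind1)/(Ind2)-stable `W` with `thetaRegion3 ⊆ c • W ∈ Hul` whose log-volume obeys a
Step (v)-shape bound `logvol (c • W) ≤ w·qLocal + κ` (NAMED container numerics; [IUTchIV] Thm. 1.10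
Step (v) p. 28–29 with `w = j²` at label `j`), if the packet is DEEP (`κ < (w − 1)·(−qLocal)` — `ord(q)`
beyond the XXIVc threshold), then the PER-PACKET reading `∀ i v_ℚ, qLocal ≤ thetaLocal` is FALSE. The
kernel form of skel FORK-LOCAL-GLOBAL §3 at any frozen setting; `not_pointwise_real` (§6) follows at the
assembled real settings once the container instantiates `hW`/`h3`/`hHul`/`hnum`/`hdeep` (c312-5 lattice
files + deep initial Θ-data). Says NOTHING about the printed GLOBAL inequality (XXIVc
`global_of_compensation`). [claim: Mochizuki2012, status: disputed] -/
theorem not_pointwise_of_deep_packet (H : BridgeHyps P) (i : Fin T.lstar) (vQ : T.VQ)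
    {W : Set (S.L.Packet (Setting.labelSucc i) vQ)}
    (hW : ∀ Φ ∈ S.L.Ind1Family ∪ S.L.Ind2Family, Φ (Setting.labelSucc i) vQ '' W = W) (c : ℚ)
    (h3 : P.thetaRegion3 (Setting.labelSucc i) vQ ⊆ c • W)
    (hHul : c • W ∈ (P.frame (Setting.labelSucc i) vQ).Hul) {w κ : ℝ}
    (hnum : (S.D P.n).logvol (Setting.labelSucc i) vQ (c • W) ≤
      w * P.qLocal (Setting.labelSucc i) vQ + κ)
    (hdeep : κ < (w - 1) * (-P.qLocal (Setting.labelSucc i) vQ)) :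
    ¬ ∀ (i' : Fin T.lstar) (vQ' : T.VQ),
        P.qLocal (Setting.labelSucc i') vQ' ≤ (P.thetaLocal (Setting.labelSucc i') vQ').untopD 0 := by
  intro hpt
  have hUB : (P.thetaLocal (Setting.labelSucc i) vQ).untopD 0 ≤
      w * P.qLocal (Setting.labelSucc i) vQ + κ :=
    (thetaLocal_untopD_le_logvol_of_stable_smul H i vQ hW c h3 hHul).trans hnum
  exact absurd (perPlace_bound_of_pointwise (hpt i vQ) hUB) (not_le.mpr hdeep)

end Cor312Vol

end IUTFork

end Summit.ABC

end
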